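import Mathlib
import HarnessLib
import HarnessLib.Audit
import Summits.FinalStateConjecture.Statement

/-!
Route: PocketUniverses

CLOSED (retired) 2026-08-17T04:44:16Z by planner-rrefute-FinalStateConjecture-PocketUni-7468e812-0 — reason: line refuted on paper (no Lean theorem possible: needs MGHD geometry): PocketExists refuted-misstated by refuter rattack-18854 and its faithful repair C' makes the support item PocketsDefeatCharts false via tendril decompositions (TENDRILS. — note: route-repair (planner rrefute-PocketUni-7468e812): PocketExists (18854) refuted-misstated by refuter rattack-18854 (clause (b) ranges over flat charts with U0 ⊇ E only; doctored components violate it in every MGHD of the seed). The faithful repair C' (rho_i → ∞ + conclusion restricted to the honest . The file is kept as the record of this route; refuted decls are indexed as negative knowledge (`ledger negatives`).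

# Route PocketUniverses — expanding pockets behind the horizon carry complete interior null rays no
chart certifies — the re-typed summit fails openly

REFUTATION ROUTE (`closes : PocketExists → PocketsAreStable → PocketsDefeatCharts → ¬
FinalStateConjecture`,
opened with --refutation). It suffices, to refute the summit AS RE-TYPED on 2026-08-16 (T2: clause C
`RaysStayInClosure` demands that EVERY future-complete normalised null ray from Σ stay in `closure
O`, and clause F2
`HasExhaustiveCharts` that every point of `O` be certified-late or causally below a certified slab),
to show X = A ∧ B.
A (PocketExists): there is an admissible one-ended vacuum datum d₀ — an asymptotically flat end
joined through an
Einstein–Rosen neck to a compact expanding hyperbolic POCKET (a slice of a closed Milne = Löbell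
spacetime) — every
MGHD of which carries a POCKET STRUCTURE: an open Q (the pocket's own domain of outer
communications), a hole tube 𝒯
and a continuous time function T monotone along J⁺ such that (a) an open set of data points emit
future-complete
normalised null rays eventually inside Q ∖ closure 𝒯 with T → ∞, (b) every late flat chart's slabs
are eventually
disjoint from J⁺(Q), (c) every late boosted-Kerr chart with honest growing radii has its certified
region in Q
eventually inside 𝒯 and T bounded on its converged slabs ∩ J⁺(Q). B (PocketsAreStable): along every
jointly smooth admissible family, the set of parameters whose MGHDs
are all pocketed is a neighbourhood of 0 once it contains 0. The support item
PocketsDefeatCharts (provable now) shows a pocket structure excludes every (O, d) with O =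
exteriorOf, clause C and
clause F2; pure logic then refutes tame Christodoulou genericity at d₀.
Lean: `PocketExists ∧ PocketsAreStable`

## Assembly
Pure logic, kernel-checked in Sketch.lean / glue.lean (`lean check` rc 0, no sorry, 2026-08-17):
from PocketExists take
X, d₀; PocketsAreStable at d₀ gives pocket structures along every smooth admissible family near 0;
the constant family
and PocketsDefeatCharts show d₀ is exceptional for the re-typed property (its first conjunct
supplies an MGHD, its
second the forbidden (O, d)); `FinalStateConjecture` at X (`IsTameChristodoulouGeneric` =
`HasTameCodimAtLeastIn … 1`)
then yields a tame immersed injective admissible family F through d₀ all of whose members c ≠ 0 are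
good; but
`Metric.eventually_nhds_iff` gives a ball of good-for-us parameters and `EuclideanSpace.single 0
(ε/2)` a non-zero one
in it, whose MGHD carries a pocket structure and a forbidden decomposition at once. The refutation
form is
`¬ FinalStateConjecture` by name.

Rationale: WHY THIS LINE. Every one of the 45 open routes is positive-side and treats black-hole INTERIORS as
invisible (card excise-the-unknown,
graded 2026-08-15, states that principle; it was correct for the g6 typing). The T2 re-type added
clause C, which
quantifies over ALL future-complete normalised null rays from Σ — including rays that never leave a
black hole. Gluing
(Isenberg–Mazzeo–Pollack arXiv:gr-qc/0109045, Chruściel–Isenberg–Pollack arXiv:gr-qc/0403066,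
no-KIDs genericity
arXiv:gr-qc/0403042) puts a closed hyperbolic Löbell slice behind a small neck of one-ended AF
vacuum data; causally,
the pocket's far side is a second exterior of the neck black hole; dynamically it expands forever
(Andersson–Moncrief
arXiv:gr-qc/0303045, arXiv:0908.0784), so it carries complete interior rays, while the chart clauses
can never certify
it (late flat slabs are complete quasi-Euclidean |k| ≤ ε hypersurfaces, which do not fit in I⁺(0)/Γ;
the one pocket
Kerr–Schild chart certifies hyperbolic radius < inj; a time function bounds causal pasts of
converged slabs). Imported:
cosmological future-stability (Λ = 0 hyperbolic Einstein flow), initial-data gluing, Lorentzian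
comparison geometry,
and the printed open direction of Hintz arXiv:2408.06715 p. 4 (global-in-time gluing of a small
black hole along a
future-complete geodesic of an expanding background) at Λ = 0. What no route and no negative does:
it is the first
line that makes the INTERIOR decide the typed statement, and it exhibits an OPEN set of exceptional
data.

RANKED CRUXES. #2 PocketExists (crux) — there are a one-ended 3-manifold X and an admissible vacuum
datum d₀ (AF end # expanding closed-hyperbolic pocket through an Einstein–Rosen neck) every MGHD of
which carries a pocket structure (Q, 𝒯, T with (a) complete pocket rays from an open set of data
points, eventually in Q ∖ closure 𝒯, T → ∞; (b) late flat charts' slabs eventually disjoint from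
J⁺(Q); (c) late boosted-Kerr charts with honest radii certify inside Q only within 𝒯, T bounded on
their converged slabs ∩ J⁺(Q)). Printed anchor: Hintz arXiv:2408.06715 p. 4 "The construction of g_ε
on larger subsets of M … requires, at the very least, detailed control of perturbations of (M, g) …
in the full causal future of X. It may be feasible to attempt gluing a small black hole along a
future-complete geodesic when (M, g) is de Sitter space" — here at Λ = 0 with the closed Milne
background, whose unpunctured future stability is Andersson–Moncrief. [difficulty: open-problem]
(why it might fail: Needs the GLOBAL future of a small black hole in closed Milne (Hintz
arXiv:2408.06715 p4: open beyond finite time / de Sitter); clause (b) rests on an unproved cone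
lemma (no complete quasi-Euclidean |k|≤ε slab in I⁺(0)/Γ); clause (c) on curvature/injectivity
pinning of near-KS charts.) [arXiv:2408.06715, arXiv:2306.07409, arXiv:gr-qc/0303045,
arXiv:0908.0784, arXiv:gr-qc/0109045, arXiv:gr-qc/0403066, arXiv:gr-qc/0403042, arXiv:2001.10401,
arXiv:2307.04405]
#3 PocketsAreStable (crux) — along every jointly smooth admissible one-parameter family F on any X,
the set S of parameters c all of whose MGHDs of F c carry a pocket structure is a neighbourhood of 0
as soon as 0 ∈ S (openness of the pocket structure at the base of every smooth admissible family;
the topology tame families respect is C^∞_loc everywhere, hence small on the neck and the pocket).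
[deps: PocketExists] [difficulty: XL] (why it might fail: Universal over ALL carriers of a pocket
structure: an exotic non-robust carrier (degenerate-horizon interior with complete rays) falsifies
it; for Löbell carriers it is Cauchy stability + uniform Andersson–Moncrief asymptotics with an
excised hole + persistent causal isolation, unproved at Λ=0.) [arXiv:gr-qc/0303045, arXiv:0908.0784,
arXiv:2408.06712, arXiv:1710.01722, Christodoulou1999]
#9 PocketsDefeatCharts (support) — for every vacuum Cauchy development carrying a pocket structure
there is no region O with a C² final-state decomposition d such that O = exteriorOf 𝒟 d.charted,
RaysStayInClosure 𝒟 O and HasExhaustiveCharts d (causal bookkeeping: choose the chart time τ₂ beyond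
the finitely many eventualities (b), (c) supply for d's own charts and radii, Θ a bound for T on the
level-τ₂ hole slabs ∩ J⁺(Q), a late pocket-ray point y ∈ Q ∖ closure 𝒯 with T y > Θ; y ∈ closure O
gives x ∈ O ∩ Q ∖ closure 𝒯 with T x > Θ, not certified-late at level τ₂, hence x ≤ z for a point z
of a certified slab at level τ₂, so T x ≤ T z ≤ Θ — contradiction). [difficulty: provable-now]
[arXiv:1710.01722, Christodoulou1999, arXiv:0811.0354]

TWO-LAYER PLAN. Foreseen (filed only after a crux moves; registered now as BC3 skeletons
bc/*_birth.lean): PocketExists ⇐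
PocketSeedsExist (∀ L δ > 0 ∃ T₀ X d₀, PocketSeed X d₀ T₀ L δ: IMP/CIP connected sum of an AF vacuum
end with a closed
hyperbolic Löbell slice, mass ≤ δ T₀, an embedded hyperbolic ball of radius L·T₀; typed helper
`PocketSeed`) →
SeedsDevelopPockets (∃ L δ, every seed develops the pocket structure in every MGHD: punctured-Löbell
global future +
cone lemma + chart pinning) → PocketExists. PocketsAreStable ⇐ CompactKicksStable (stability under
compactly supported
smooth admissible kicks) → KicksSuffice (locality: domain of dependence of the compact pocket side,
MGHD locality
CBG/Sbierski) → PocketsAreStable.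

KILL CRITERIA. `refuted:PocketExists` if the cone lemma fails (a late flat chart with C²-deviation →
0 whose slabs lie inside the
solid cone I⁺(0) ⊂ E4 exists) AND no other obstruction pins flat charts out of expanding pockets —
then clause (b) is
unsatisfiable and the line is dead (the pocket can be certified as "radiation zone" by a winding
flat chart).
`refuted:PocketsAreStable` by an exotic non-robust carrier ⇒ pivot: restate B with the hypothesis
strengthened to the
explicit Löbell seeds of layer 2 (SeedsDevelopPockets made robust), same glue. Mooted (`retire`) if
the operator
re-types clause C to rays escaping to the asymptotically flat end (or restricts "settles down" to J⁻
of the far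
region): the route's purpose is exactly to force that decision; record it in BARRIERS.md as the
interior-ray caveat.
PocketsDefeatCharts is provable now; its failure would mean a mis-typed clause in this route, repair
by restate.

NOT DECOMPOSED YET. The seed construction (parametric IMP/CIP gluing with a neck of mass ≤ δ T₀ and
exact Löbell data on the pocket), the
punctured-Löbell future-stability theorem (CMC/Bel–Robinson energy with an excised Kerr(ε) hole,
causal isolation of
the two exteriors of the neck, Lorentzian distance from Σ as T), the cone lemma (entire spacelike
graphs inside I⁺(0)
have sub-Euclidean volume growth, so no complete |k| ≤ ε slab is globally (1+ε)-quasi-Euclidean) and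
the pinning of
Kerr–Schild charts (curvature matching forces M' ≈ m at the physical hole, injectivity forces
certified hyperbolic
radius < inj(o)) are all layer-2 material behind the two registered stubs of PocketExists; nothing
below is an item.

CHEAPEST FALSIFIER. The cone lemma in EXACT Minkowski space, on paper or in Lean over
`Minkowski.spacetime`: is there an open embedding
Φ of {x⁰ > τ₀} ∖ (sublinear tube) into the solid cone {x⁰ > |x̲|} ⊂ E4 with Φ*η − η → 0 in C² on the
slabs {x⁰ = τ}?
If YES, clause (b) of the pocket structure is unsatisfiable in Löbell pockets and PocketExists dies
as typed. Run by
me this session only as a volume-growth computation on paper (an entire spacelike graph u > |x| with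
|∇u| < 1 has
radial proper length ≤ √(2u(0)R) out to coordinate radius R, incompatible with Euclidean volume
growth of a
(1+ε)-bi-Lipschitz parametrisation); not yet kernel-checked.

NUMBERS. Typed constants copied from the Statement: C² (k = 2) deviations; honest radii R ≥ max(r₊,
0) + 1, R → ∞; tame
codimension m = 1. Model constants of the seed: pocket curvature −T₀⁻², expansion k = T₀⁻¹ h
(umbilic), neck mass
≤ δ T₀, embedded hyperbolic ball of radius L·T₀ (layer-2 parameters; the certified cone of a pocket
Kerr–Schild chart
has hyperbolic radius < inj(o), so L is chosen > inj(o) + 1 with a pocket of out-radius > L). Items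
at open: 4
(2 cruxes, 1 support, 1 assembly).

DEFINITION REQUESTS. None at open (the pocket structure is inlined verbatim in the three items;
`PocketSeed` lives in the BC3 skeleton).
Cite facts wanted later (not load-bearing for `closes`): Andersson–Moncrief future completeness of
Löbell perturbations
(arXiv:gr-qc/0303045 Thm 1.1 / arXiv:0908.0784), IMP/CIP connected-sum gluing (arXiv:gr-qc/0109045,
arXiv:gr-qc/0403066).

Novelty: Searches (2026-08-17): OQH corpus (frontier.json 60 rows, reads.jsonl 5, new.md 44 works) +
page-level `lit read --grep` of 11 primaries (arXiv:2608.11706, 2401.02003, 2606.28253, 2212.14093,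
2402.10190, 2606.07781, 2603.23437, 2604.17599, 2303.12758, 2307.04405, 2408.06715); `lit search
--source arxiv` for "gluing small black holes along timelike geodesics" (3: Hintz I–III), "Milne
stability Einstein" (9: Wang–Yuan 2307.04405, Andersson–Fajman 1709.00267,
Fajman–Ofner–Oliynyk–Wyatt 2301.11191, Branding–Fajman–Kröncke 1804.04934 …), "Future complete
vacuum spacetimes Andersson Moncrief" (gr-qc/0303045), "Einstein spaces attractors Einstein flow"
(0908.0784, 2401.02060), "Gluing wormholes Einstein constraint equations" (gr-qc/0109045), "Initial
data engineering" (gr-qc/0403066), "Black hole gluing de Sitter Hintz" (2001.10401, 2504.08869), "de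
Sitter no-hair theorem cosmologies Vasy" (2004.10754), "baby universe inside black hole vacuum
initial data hyperbolic" (0), "expanding universe inside black hole Einstein Rosen bridge closed
hyperbolic" (0), "final state conjecture counterexample topology interior" (0); `lit galaxy search
--star all` "universe inside a black hole wormhole expanding" (0) and "baby universe black hole"
(0); OpenAlex ERR this session; grep of all 58 Theses and 16 idea cards of the sub for
pocket/interior/Gannon/bag of gold/topology (cards excise-the-unknown,
exotic-ends-topology-must-be-swallowed (absorbed), horizon-seam-euler-characteristic; no route).
Ne  [refs: 2608.11706, 2408.06715, gr-qc/0303045]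

Barriers (technique_class: causal-structure, cosmological-stability, gluing): - technique_class: causal-structure, cosmological-stability, gluing
- Literature.Barriers.FinalStateConjecture.SlowlyRotatingKerrFrontier: not engaged — no exterior
Kerr stability is invoked (the AF side of the seed is exact Schwarzschild data; the dynamics is on
the pocket side, an expanding Λ = 0 cosmology).
- Literature.Barriers.FinalStateConjecture.AretakisInstability: not engaged — no extremal or
near-extremal horizon occurs (neck = Schwarzschild(m), pocket hole sub-extremal with a ≈ 0); named
only because PocketsAreStable's why-might-fail points at degenerate-horizon interiors as the
conceivable exotic carriers.
- Literature.Barriers.FinalStateConjecture.nakedSingularityInstability: not engaged — no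
genericity-by-instability argument is made; the route exhibits an OPEN exceptional set, the opposite
regime of Christodoulou's codimension count, and the exceptional members have complete 𝓘⁺ and
settled exteriors (they fail clause C only).
- Literature.Barriers.FinalStateConjecture.SbierskiTrappingObstruction: not engaged — no decay
estimate on a trapping exterior is needed; the pocket has no trapping outside its hole tube.
- Literature.Barriers.FinalStateConjecture.PriceLawTail: not engaged (the typed clauses carry no
rates; the pocket argument is causal/comparison-geometric).
- Literature.Barriers.FinalStateConjecture.IonescuKlainermanNonExtension: not engaged — no
rigidity/unique-continuation step.
- Literature.Barriers.FinalStateConjecture.GregoryLaflammeInstability: not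

History (route lifecycle, newest last):
- 2026-08-17T04:44:16Z · CLOSED retired — line refuted on paper (no Lean theorem possible: needs MGHD geometry): PocketExists refuted-misstated by refuter rattack-18854 and its faithful repair C' makes the support item PocketsDefeatCharts fal (planner-rrefute-FinalStateConjecture-PocketUni-7468e812-0)

sub-problem: FinalStateConjecture · status: closed(retired) · opened planner-plan-lens3-FinalStateConjecture-oqh-g2-0 2026-08-17T03:04:50Z · rev 0 · ledger route-FinalStateConjecture-PocketUniverses
GENERATED by the gate from the ledger (D-0016/17). Provers cite these decls: `theorem foo : Summit.FinalStateConjecture.FinalStateConjecture.Theses.PocketUniverses.<Decl> := …` in Summits/FinalStateConjecture/FinalStateConjecture/Theorems/<Name>.lean.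
-/

namespace Summit.FinalStateConjecture.FinalStateConjecture.Theses.PocketUniverses

open scoped BigOperators Topology Manifold Classical MeasureTheory ProbabilityTheory Matrix InnerProductSpace ComplexConjugate ContinuousMap
open Filter Set Function TopologicalSpace MeasureTheory

attribute [summit_statement] _root_.FinalStateConjecture

/-- item stmt-FinalStateConjecture-18854 · crux · rank 2 · closed · moot by None · by planner
why it might fail: Needs the GLOBAL future of a small black hole in closed Milne (Hintz arXiv:2408.06715 p4: open beyond finite time / de Sitter); clause (b) rests on an unproved cone lemma (no complete quasi-Euclidean |k|≤ε slab in I⁺(0)/Γ); clause (c) on curvature/injectivity pinning of near-KS charts.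
sources: arXiv:2408.06715, arXiv:2306.07409, arXiv:gr-qc/0303045, arXiv:0908.0784, arXiv:gr-qc/0109045, arXiv:gr-qc/0403066
[crux] there are a one-ended 3-manifold X and an admissible vacuum datum d₀ (AF end # expanding
closed-hyperbolic pocket through an Einstein–Rosen neck) every MGHD of which carries a pocket
structure (Q, 𝒯, T with (a) complete pocket rays from an open set of data points, eventually in Q ∖
closure 𝒯, T → ∞; (b) late flat charts' slabs eventually disjoint from J⁺(Q); (c) late boosted-Kerr
charts with honest radii certify inside Q only within 𝒯, T bounded on their converged slabs ∩
J⁺(Q)). Printed anchor: Hintz arXiv:2408.06715 p. 4 "The construction of g_ε on larger subsets of M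
… requires, at the very least, detailed control of perturbations of (M, g) … in the full causal
future of X. It may be feasible to attempt gluing a small black hole along a future-complete
geodesic when (M, g) is de Sitter space" — here at Λ = 0 with the closed Milne background, whose
unpunctured future stability is Andersson–Moncrief. [difficulty: open-problem] -/
@[route_item "route-FinalStateConjecture-PocketUniverses"]
def PocketExists : Prop :=
  ∃ (X : Type) (_ : TopologicalSpace X) (_ : ChartedSpace Literature.Geometry.Lorentzian.E3 X) (_ : IsManifold (𝓡 3) ((⊤ : ℕ∞) : WithTop ℕ∞) X) (_ : T2Space X) (_ : SecondCountableTopology X) (_ : ConnectedSpace X) (d₀ : Literature.Geometry.Lorentzian.InitialDataSet (𝓡 3) X), d₀ ∈ Literature.Geometry.Lorentzian.admissibleVacuumData X ∧ ∀ 𝒟 : Literature.Geometry.Lorentzian.VacuumCauchyDevelopment d₀, 𝒟.IsMaximal → (𝒟.metric.HasLeviCivita ∧ ∃ (Q 𝒯 : Set 𝒟.carrier) (T : 𝒟.carrier → ℝ), IsOpen Q ∧ Continuous T ∧ (∀ x z : 𝒟.carrier, z ∈ 𝒟.metric.causalFuture 𝒟.timeOrientation {x} → T x ≤ T z) ∧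 (∀ [𝒟.metric.HasLeviCivita], ∃ V : Set X, IsOpen V ∧ V.Nonempty ∧ ∀ p ∈ V, ∃ (γ : ℝ → 𝒟.carrier) (dom : Set ℝ) (t₀ : ℝ), 𝒟.metric.IsNormalisedNullRayFrom 𝒟.timeOrientation 𝒟.embed 𝒟.normal p γ dom ∧ ¬ BddAbove dom ∧ 0 ≤ t₀ ∧ (∀ t ∈ dom, t₀ ≤ t → γ t ∈ Q ∧ γ t ∉ closure 𝒯) ∧ ∀ B : ℝ, ∃ t ∈ dom, t₀ ≤ t ∧ B < T (γ t)) ∧ (∀ (U₀ : TopologicalSpace.Opens Literature.Geometry.Lorentzian.E4) (Ψ₀ : U₀ → 𝒟.carrier) (s₁ : ℝ) (n : ℕ) (mo : Fin n → Literature.Geometry.Lorentzian.lorentzGroup × Literature.Geometry.Lorentzian.E4) (sp : Fin n → ℝ) (ρ : Fin n → ℝ → ℝ), (∀ i, Tendsto (fun t ↦ ρ i t / t) atTop (𝓝 0)) → {x : Literature.Geometry.Lorentzian.E4 | s₁ < x 0 ∧ ∀ i, ρ i (x 0) < Literature.Geometry.Lorentzian.Kerr.radius (sp i) (Literature.Geometry.Lorentzian.poincareInv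 (mo i).1 (mo i).2 x)} ⊆ (U₀ : Set Literature.Geometry.Lorentzian.E4) → 𝒟.toSpacetime.IsLateChart (Literature.Geometry.Lorentzian.Minkowski.backgroundOn U₀) (𝒟.metric.causalFuture 𝒟.timeOrientation (range 𝒟.embed)) s₁ Ψ₀ → Tendsto (fun s ↦ 𝒟.toSpacetime.deviationCk (Literature.Geometry.Lorentzian.Minkowski.backgroundOn U₀) Ψ₀ 2 s) atTop (𝓝 0) → ∃ s₀ : ℝ, ∀ s, s₀ ≤ s → Disjoint (Ψ₀ '' (Literature.Geometry.Lorentzian.Minkowski.backgroundOn U₀).timeSlab s) (𝒟.metric.causalFuture 𝒟.timeOrientation Q)) ∧ (∀ (Λ' : Literature.Geometry.Lorentzian.lorentzGroup) (c' : Literature.Geometry.Lorentzian.E4) (M' a' s₁ : ℝ) (Ψ : Literature.Geometry.Lorentzian.boostedKerrExterior Λ' c' M' a' → 𝒟.carrier) (R : ℝ → ℝ), 0 < M' → |a'| ≤ M' → 𝒟.toSpacetime.IsLateChart (Literature.Geometry.Lorentzian.boostedKerrBackground Λ' c' M' a') (𝒟.metric.causalFuture 𝒟.timeOrientation (range 𝒟.embed))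 s₁ Ψ → Tendsto R atTop atTop → (∀ s, max (Literature.Geometry.Lorentzian.Kerr.rPlus M' a') 0 + 1 ≤ R s) → Tendsto (fun s ↦ 𝒟.toSpacetime.truncDeviationCk (Literature.Geometry.Lorentzian.boostedKerrBackground Λ' c' M' a') Ψ 2 (R s) s) atTop (𝓝 0) → ∃ s₀ : ℝ, Ψ '' {x | s₀ < (Literature.Geometry.Lorentzian.boostedKerrBackground Λ' c' M' a').time x.1 ∧ (Literature.Geometry.Lorentzian.boostedKerrBackground Λ' c' M' a').radius x.1 ≤ R ((Literature.Geometry.Lorentzian.boostedKerrBackground Λ' c' M' a').time x.1)} ∩ Q ⊆ 𝒯 ∧ ∀ s, s₀ ≤ s → BddAbove (T '' (Ψ '' (Literature.Geometry.Lorentzian.boostedKerrBackground Λ' c' M' a').truncTimeSlab (R s) s ∩ 𝒟.metric.causalFuture 𝒟.timeOrientation Q))))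

/-- item stmt-FinalStateConjecture-18855 · crux · rank 3 · closed · moot by None · by planner
why it might fail: Universal over ALL carriers of a pocket structure: an exotic non-robust carrier (degenerate-horizon interior with complete rays) falsifies it; for Löbell carriers it is Cauchy stability + uniform Andersson–Moncrief asymptotics with an excised hole + persistent causal isolation, unproved at Λ=0.
sources: arXiv:gr-qc/0303045, arXiv:0908.0784, arXiv:2408.06712, arXiv:1710.01722, Christodoulou1999
[crux] along every jointly smooth admissible one-parameter family F on any X, the set S of
parameters c all of whose MGHDs of F c carry a pocket structure is a neighbourhood of 0 as soon as 0
∈ S (openness of the pocket structure at the base of every smooth admissible family; the topology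
tame families respect is C^∞_loc everywhere, hence small on the neck and the pocket). [deps:
PocketExists] [difficulty: XL] -/
@[route_item "route-FinalStateConjecture-PocketUniverses"]
def PocketsAreStable : Prop :=
  ∀ (X : Type) [TopologicalSpace X] [ChartedSpace Literature.Geometry.Lorentzian.E3 X] [IsManifold (𝓡 3) ((⊤ : ℕ∞) : WithTop ℕ∞) X] [T2Space X] [SecondCountableTopology X] [ConnectedSpace X], ∀ F : EuclideanSpace ℝ (Fin 1) → Literature.Geometry.Lorentzian.InitialDataSet (𝓡 3) X, Literature.Geometry.Lorentzian.InitialDataSet.IsSmoothDataFamily 1 F → (∀ c, F c ∈ Literature.Geometry.Lorentzian.admissibleVacuumData X) → ∀ S : Set (EuclideanSpace ℝ (Fin 1)), S = {c | ∀ 𝒟 : Literature.Geometry.Lorentzian.VacuumCauchyDevelopment (F c), 𝒟.IsMaximal → (𝒟.metric.HasLeviCivita ∧ ∃ (Q 𝒯 : Set 𝒟.carrier) (T : 𝒟.carrier → ℝ), IsOpen Q ∧ Continuous T ∧ (∀ x z : 𝒟.carrier, z ∈ 𝒟.metric.causalFuture 𝒟.timeOrientation {x} → T x ≤ T z) ∧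 (∀ [𝒟.metric.HasLeviCivita], ∃ V : Set X, IsOpen V ∧ V.Nonempty ∧ ∀ p ∈ V, ∃ (γ : ℝ → 𝒟.carrier) (dom : Set ℝ) (t₀ : ℝ), 𝒟.metric.IsNormalisedNullRayFrom 𝒟.timeOrientation 𝒟.embed 𝒟.normal p γ dom ∧ ¬ BddAbove dom ∧ 0 ≤ t₀ ∧ (∀ t ∈ dom, t₀ ≤ t → γ t ∈ Q ∧ γ t ∉ closure 𝒯) ∧ ∀ B : ℝ, ∃ t ∈ dom, t₀ ≤ t ∧ B < T (γ t)) ∧ (∀ (U₀ : TopologicalSpace.Opens Literature.Geometry.Lorentzian.E4) (Ψ₀ : U₀ → 𝒟.carrier) (s₁ : ℝ) (n : ℕ) (mo : Fin n → Literature.Geometry.Lorentzian.lorentzGroup × Literature.Geometry.Lorentzian.E4) (sp : Fin n → ℝ) (ρ : Fin n → ℝ → ℝ), (∀ i, Tendsto (fun t ↦ ρ i t / t) atTop (𝓝 0)) → {x : Literature.Geometry.Lorentzian.E4 | s₁ < x 0 ∧ ∀ i, ρ i (x 0) < Literature.Geometry.Lorentzian.Kerr.radius (sp i) (Literature.Geometry.Lorentzian.poincareInv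 (mo i).1 (mo i).2 x)} ⊆ (U₀ : Set Literature.Geometry.Lorentzian.E4) → 𝒟.toSpacetime.IsLateChart (Literature.Geometry.Lorentzian.Minkowski.backgroundOn U₀) (𝒟.metric.causalFuture 𝒟.timeOrientation (range 𝒟.embed)) s₁ Ψ₀ → Tendsto (fun s ↦ 𝒟.toSpacetime.deviationCk (Literature.Geometry.Lorentzian.Minkowski.backgroundOn U₀) Ψ₀ 2 s) atTop (𝓝 0) → ∃ s₀ : ℝ, ∀ s, s₀ ≤ s → Disjoint (Ψ₀ '' (Literature.Geometry.Lorentzian.Minkowski.backgroundOn U₀).timeSlab s) (𝒟.metric.causalFuture 𝒟.timeOrientation Q)) ∧ (∀ (Λ' : Literature.Geometry.Lorentzian.lorentzGroup) (c' : Literature.Geometry.Lorentzian.E4) (M' a' s₁ : ℝ) (Ψ : Literature.Geometry.Lorentzian.boostedKerrExterior Λ' c' M' a' → 𝒟.carrier) (R : ℝ → ℝ), 0 < M' → |a'| ≤ M' → 𝒟.toSpacetime.IsLateChart (Literature.Geometry.Lorentzian.boostedKerrBackground Λ' c' M' a') (𝒟.metric.causalFuture 𝒟.timeOrientation (range 𝒟.embed))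 s₁ Ψ → Tendsto R atTop atTop → (∀ s, max (Literature.Geometry.Lorentzian.Kerr.rPlus M' a') 0 + 1 ≤ R s) → Tendsto (fun s ↦ 𝒟.toSpacetime.truncDeviationCk (Literature.Geometry.Lorentzian.boostedKerrBackground Λ' c' M' a') Ψ 2 (R s) s) atTop (𝓝 0) → ∃ s₀ : ℝ, Ψ '' {x | s₀ < (Literature.Geometry.Lorentzian.boostedKerrBackground Λ' c' M' a').time x.1 ∧ (Literature.Geometry.Lorentzian.boostedKerrBackground Λ' c' M' a').radius x.1 ≤ R ((Literature.Geometry.Lorentzian.boostedKerrBackground Λ' c' M' a').time x.1)} ∩ Q ⊆ 𝒯 ∧ ∀ s, s₀ ≤ s → BddAbove (T '' (Ψ '' (Literature.Geometry.Lorentzian.boostedKerrBackground Λ' c' M' a').truncTimeSlab (R s) s ∩ 𝒟.metric.causalFuture 𝒟.timeOrientation Q))))} → (0 : EuclideanSpace ℝ (Fin 1)) ∈ S → S ∈ 𝓝 (0 : EuclideanSpace ℝ (Fin 1))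

/-- item stmt-FinalStateConjecture-18856 · support · rank 9 · closed · moot by None · by planner
sources: arXiv:1710.01722, Christodoulou1999, arXiv:0811.0354
[support] for every vacuum Cauchy development carrying a pocket structure there is no region O with
a C² final-state decomposition d such that O = exteriorOf 𝒟 d.charted, RaysStayInClosure 𝒟 O and
HasExhaustiveCharts d (causal bookkeeping: choose the chart time τ₂ beyond the finitely many
eventualities (b), (c) supply for d's own charts and radii, Θ a bound for T on the level-τ₂ hole
slabs ∩ J⁺(Q), a late pocket-ray point y ∈ Q ∖ closure 𝒯 with T y > Θ; y ∈ closure O gives x ∈ O ∩ Q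
∖ closure 𝒯 with T x > Θ, not certified-late at level τ₂, hence x ≤ z for a point z of a certified
slab at level τ₂, so T x ≤ T z ≤ Θ — contradiction). [difficulty: provable-now] -/
@[route_item "route-FinalStateConjecture-PocketUniverses"]
def PocketsDefeatCharts : Prop :=
  ∀ (X : Type) [TopologicalSpace X] [ChartedSpace Literature.Geometry.Lorentzian.E3 X] [IsManifold (𝓡 3) ((⊤ : ℕ∞) : WithTop ℕ∞) X] [T2Space X] [SecondCountableTopology X] [ConnectedSpace X] (D : Literature.Geometry.Lorentzian.InitialDataSet (𝓡 3) X) (𝒟 : Literature.Geometry.Lorentzian.VacuumCauchyDevelopment D), (𝒟.metric.HasLeviCivita ∧ ∃ (Q 𝒯 : Set 𝒟.carrier) (T : 𝒟.carrier → ℝ), IsOpen Q ∧ Continuous T ∧ (∀ x z : 𝒟.carrier, z ∈ 𝒟.metric.causalFuture 𝒟.timeOrientation {x} → T x ≤ T z) ∧ (∀ [𝒟.metric.HasLeviCivita], ∃ V : Set X, IsOpen V ∧ V.Nonempty ∧ ∀ p ∈ V, ∃ (γ : ℝ → 𝒟.carrier) (dom : Set ℝ) (t₀ : ℝ), 𝒟.metric.IsNormalisedNullRayFrom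 𝒟.timeOrientation 𝒟.embed 𝒟.normal p γ dom ∧ ¬ BddAbove dom ∧ 0 ≤ t₀ ∧ (∀ t ∈ dom, t₀ ≤ t → γ t ∈ Q ∧ γ t ∉ closure 𝒯) ∧ ∀ B : ℝ, ∃ t ∈ dom, t₀ ≤ t ∧ B < T (γ t)) ∧ (∀ (U₀ : TopologicalSpace.Opens Literature.Geometry.Lorentzian.E4) (Ψ₀ : U₀ → 𝒟.carrier) (s₁ : ℝ) (n : ℕ) (mo : Fin n → Literature.Geometry.Lorentzian.lorentzGroup × Literature.Geometry.Lorentzian.E4) (sp : Fin n → ℝ) (ρ : Fin n → ℝ → ℝ), (∀ i, Tendsto (fun t ↦ ρ i t / t) atTop (𝓝 0)) → {x : Literature.Geometry.Lorentzian.E4 | s₁ < x 0 ∧ ∀ i, ρ i (x 0) < Literature.Geometry.Lorentzian.Kerr.radius (sp i) (Literature.Geometry.Lorentzian.poincareInv (mo i).1 (mo i).2 x)} ⊆ (U₀ : Set Literature.Geometry.Lorentzian.E4) → 𝒟.toSpacetime.IsLateChart (Literature.Geometry.Lorentzian.Minkowski.backgroundOn U₀) (𝒟.metric.causalFuture 𝒟.timeOrientation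 (range 𝒟.embed)) s₁ Ψ₀ → Tendsto (fun s ↦ 𝒟.toSpacetime.deviationCk (Literature.Geometry.Lorentzian.Minkowski.backgroundOn U₀) Ψ₀ 2 s) atTop (𝓝 0) → ∃ s₀ : ℝ, ∀ s, s₀ ≤ s → Disjoint (Ψ₀ '' (Literature.Geometry.Lorentzian.Minkowski.backgroundOn U₀).timeSlab s) (𝒟.metric.causalFuture 𝒟.timeOrientation Q)) ∧ (∀ (Λ' : Literature.Geometry.Lorentzian.lorentzGroup) (c' : Literature.Geometry.Lorentzian.E4) (M' a' s₁ : ℝ) (Ψ : Literature.Geometry.Lorentzian.boostedKerrExterior Λ' c' M' a' → 𝒟.carrier) (R : ℝ → ℝ), 0 < M' → |a'| ≤ M' → 𝒟.toSpacetime.IsLateChart (Literature.Geometry.Lorentzian.boostedKerrBackground Λ' c' M' a') (𝒟.metric.causalFuture 𝒟.timeOrientation (range 𝒟.embed)) s₁ Ψ → Tendsto R atTop atTop → (∀ s, max (Literature.Geometry.Lorentzian.Kerr.rPlus M' a') 0 + 1 ≤ R s) → Tendsto (fun s ↦ 𝒟.toSpacetime.truncDeviationCk (Literature.Geometry.Lorentzian.boostedKerrBackground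 Λ' c' M' a') Ψ 2 (R s) s) atTop (𝓝 0) → ∃ s₀ : ℝ, Ψ '' {x | s₀ < (Literature.Geometry.Lorentzian.boostedKerrBackground Λ' c' M' a').time x.1 ∧ (Literature.Geometry.Lorentzian.boostedKerrBackground Λ' c' M' a').radius x.1 ≤ R ((Literature.Geometry.Lorentzian.boostedKerrBackground Λ' c' M' a').time x.1)} ∩ Q ⊆ 𝒯 ∧ ∀ s, s₀ ≤ s → BddAbove (T '' (Ψ '' (Literature.Geometry.Lorentzian.boostedKerrBackground Λ' c' M' a').truncTimeSlab (R s) s ∩ 𝒟.metric.causalFuture 𝒟.timeOrientation Q)))) → ¬ ∃ (O : Set 𝒟.carrier) (d : Literature.Geometry.Lorentzian.FinalStateDecomposition 𝒟.toSpacetime O 2), O = Summit.FinalStateConjecture.exteriorOf 𝒟.toCauchyDevelopment d.charted ∧ Summit.FinalStateConjecture.RaysStayInClosure 𝒟.toCauchyDevelopment O ∧ Summit.FinalStateConjecture.HasExhaustiveCharts d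

/-- item stmt-FinalStateConjecture-18857 · assembly · rank 1 · closed · proved by Summit.FinalStateConjecture.FinalStateConjecture.Theorems.pocketUniverses_assembly_proof @ af6cdf40e918 (prover) · by planner
sources: Christodoulou1999, arXiv:1710.01722
[assembly] PocketExists → PocketsAreStable → PocketsDefeatCharts → ¬ FinalStateConjecture (literally
the deciding theorem `closes`, opened with --refutation). -/
@[route_item "route-FinalStateConjecture-PocketUniverses"]
def Assembly : Prop :=
  PocketExists → PocketsAreStable → PocketsDefeatCharts → ¬ FinalStateConjecture

end Summit.FinalStateConjecture.FinalStateConjecture.Theses.PocketUniverses
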